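import Mathlib
import Literature.Combinatorics.Optimization.MaxThreeSatLpLowerBound

/-!
# MAX-CUT: no LP relaxation of size `2^{n^{c}}` beats `1/2` (Kothari–Meka–Raghavendra 2017/22,
Corollary 1.5, MAX-CUT clause), DERIVED from Theorem 1.10 and the Charikar–Makarychev–Makarychev
Sherali–Adams gap

Companion of `MaxThreeSatLpLowerBound.lean`.  One new named fact is vendored — the polynomial-round
Sherali–Adams lower bound for MAX-CUT of Charikar–Makarychev–Makarychev (STOC 2009, Thm 5.3), in
the `(c,s)`-form in which Kothari–Meka–Raghavendra restate and use it:

> **KMR Thm 7.4 (p. 20) = Thm 1.3 (p. 3–4) ([CharikarMM09]).** "For every `ε > 0`, there is a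
> `γ = γ(ε)` such that the `n^γ`-round Sherali-Adams relaxation for MAX-CUT does not achieve a
> `(1/2+ε, 1−ε)`-approximation" [footnote: "The results of [CharikarMM09] are actually stated in
> terms of integrality gaps, but their proofs actually show this stronger statement."]
> **CMM09 Thm 5.3 (p. 11).** "I. For every `ε > 0` there exists `γ > 0` such that the integrality gap
> of the relaxation for MAX CUT is `2 − ε` after `r = n^γ` rounds of the Sherali–Adams
> lift-and-project. II. There exist at most `1/2 + ε₀` satisfiable instances of MAX CUT (for every
> positive constant `ε₀`), such that the LP value after `r` rounds of Sherali–Adams is at least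
> `1 − ε` …"

— typed as `CharikarMakarychevMakarychev2009_maxCutSA` in the tree's Sherali–Adams currency
(`SAAchieves`, KMR Def. 3.3 / [ChanEtAl2016]: degree-`d` pseudoexpectations; the printed pair lists
the soundness `1/2 + ε` first): for all large `n` some MAX-CUT instance on `n` vertices with
`opt ≤ 1/2 + ε` has degree-`⌊n^γ⌋` Sherali–Adams value `> 1 − ε`.  RECORDED RENDERING DECISIONS:
(i) CMM's own relaxation is `r` rounds of Sherali–Adams lift-and-project on the metric-polytope LP
(their §2, p. 4); KMR's footnote is the printed warrant for the transfer to the local-distribution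
model, which is what is typed (both sources cited); (ii) "for every `n`" is typed "for every
`n ≥ n₀(ε)`" (the constructions are asymptotic); (iii) the fact is a third-party input NOT proved
here (D-0026: the single new fact of this file; its consumer is the derivation below).

Main result: `KothariMekaRaghavendra2017_cor15_maxCut_of_thm110 :
KothariMekaRaghavendra2017_thm110 → CharikarMakarychevMakarychev2009_maxCutSA →
KothariMekaRaghavendra2017_cor15_maxCut` — the printed proof of Cor. 1.5 (p. 21, "The claims for
MAX-3XOR, MAX-CUT … follow similarly") made explicit: Thm 1.2 in the form its proof delivers
(`KothariMekaRaghavendra2017_thm12_of_thm110`) with `f(m) = ⌊m^γ⌋`, `(c,s) = (1 − ε/8, 1/2 + ε/8)`,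
padding `n ↦ ⌊n^{1/H}⌋^H` (`LPRelaxation.restrict`), "gap `< 2 − ε`" ⇒ "achieves
`((2−ε)s, s)`" (`LPRelaxation.GapLT.achieves`), and `2^{n^{γ/(2H)}} ≤ m^{h f(m)}` for large `n`.

Sources: [KothariMekaRaghavendra2017] held text `paper:arxiv-1610.02704` (Thm 1.3 p. 3–4, Cor 1.5
p. 4, Thm 7.4 p. 20, proof of Cor 1.5 p. 21); [CharikarMakarychevMakarychev2009] held text
`paper:doi-10-1145-1536414-1536455` (Thm 5.3, p. 11; the relaxation, §2 p. 4).
-/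

noncomputable section

open Finset Filter

namespace Literature.Combinatorics.Optimization

/-! ### The Charikar–Makarychev–Makarychev Sherali–Adams gap for MAX-CUT (named fact) -/

/-- **Charikar–Makarychev–Makarychev 2009, Thm 5.3 (polynomial-round Sherali–Adams gap `2 − ε` for
MAX-CUT), in the `(c,s)`-form of Kothari–Meka–Raghavendra's Thm 7.4 = Thm 1.3:** for every `ε > 0`
there are `γ > 0` and `n₀` such that for every `n ≥ n₀` the degree-`⌊n^γ⌋` Sherali–Adams
relaxation fails to achieve a `(1 − ε, 1/2 + ε)`-approximation for MAX-CUT on `n` vertices (some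
instance with `opt ≤ 1/2 + ε` has a degree-`⌊n^γ⌋` pseudoexpectation of value `> 1 − ε`).  See the
module docstring for the model transfer (KMR footnote 7.4) and the threshold `n₀`.  NOT proved here.
[cite: CharikarMakarychevMakarychev2009, Thm 5.3 (p. 11)]
[cite: KothariMekaRaghavendra2017, Thm 7.4 (p. 20) and Thm 1.3 (p. 3–4)] -/
def CharikarMakarychevMakarychev2009_maxCutSA : Prop :=
  ∀ ε : ℝ, 0 < ε → ∃ γ : ℝ, 0 < γ ∧ ∃ n₀ : ℕ, ∀ n : ℕ, n₀ ≤ n →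
    ¬ SAAchieves (n := n) maxCutPreds ⌊(n : ℝ) ^ γ⌋₊ (1 - ε) (1 / 2 + ε)

/-! ### Corollary 1.5 (MAX-CUT) from Theorem 1.10 and the CMM gap -/

/-- **Kothari–Meka–Raghavendra 2017/22, Corollary 1.5 (MAX-CUT) DERIVED from Theorem 1.10 and the
Charikar–Makarychev–Makarychev gap:** for every `ε > 0` there are `c₃ > 0` and `n₀` such that for all
`n ≥ n₀` no LP relaxation of MAX-CUT on `n` vertices of size `R < 2^{n^{c₃}}` has integrality gap
less than `2 − ε`.  Proof (p. 21, "follow similarly"), made explicit: WLOG `ε ≤ 1/100`; with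
`s = 1/2 + ε/8`, `c = 1 − ε/8`, `f(m) = ⌊m^γ⌋` (`γ = γ(ε/8)` from CMM), Thm 1.2 (from Thm 1.10) makes
every LP relaxation of size `≤ m^{h f(m)}` on `m^H` variables fail `(c − 1/m, s)` for large `m`; a
relaxation on `n ≥ m^H` variables (`m = ⌊n^{1/H}⌋`) with gap `< 2 − ε` restricts to one achieving
`((2−ε)s, s)`, `(2 − ε)s ≤ c − 1/m`; and `2^{n^{c₃}} ≤ m^{h f(m)}` for `c₃ = γ/(2H)` and `n` large.
[cite: KothariMekaRaghavendra2017, Cor. 1.5 (p. 4) and its proof (§7, p. 21)] -/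
theorem KothariMekaRaghavendra2017_cor15_maxCut_of_thm110
    (h110 : KothariMekaRaghavendra2017_thm110) (hCMM : CharikarMakarychevMakarychev2009_maxCutSA) :
    KothariMekaRaghavendra2017_cor15_maxCut := by
  obtain ⟨h, H, n₀, hh, hhH, T12⟩ := KothariMekaRaghavendra2017_thm12_of_thm110 h110
  have hH0 : H ≠ 0 := by
    rintro rfl
    simp at hhH
    linarith
  have hHpos : (0 : ℝ) < H := by exact_mod_cast Nat.pos_of_ne_zero hH0
  -- WLOG `ε ≤ 1/100`
  suffices main : ∀ ε : ℝ, 0 < ε → ε ≤ 1 / 100 → ∃ c₃ : ℝ, 0 < c₃ ∧ ∃ N₀ : ℕ, ∀ N : ℕ, N₀ ≤ N →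
      ∀ R : ℕ, (R : ℝ) < (2 : ℝ) ^ ((N : ℝ) ^ c₃) →
        ∀ L : LPRelaxation 2 N maxCutPreds R, ¬ L.GapLT (2 - ε) by
    intro ε hε
    obtain ⟨c₃, hc₃, N₀, hN₀⟩ := main (min ε (1 / 100)) (lt_min hε (by norm_num)) (min_le_right _ _)
    exact ⟨c₃, hc₃, N₀, fun N hN R hR L hL =>
      hN₀ N hN R hR L (hL.mono (by linarith [min_le_left ε (1 / 100)]))⟩
  intro ε hε hε1
  -- the CMM gap at `ε/8`
  obtain ⟨γ, hγ, n₁, HCMM⟩ := hCMM (ε / 8) (by positivity)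
  -- parameters
  set s : ℝ := 1 / 2 + ε / 8 with hsdef
  set c : ℝ := 1 - ε / 8 with hcdef
  have hs0 : 0 ≤ s := by rw [hsdef]; positivity
  have hc1 : c ≤ 1 := by rw [hcdef]; linarith
  have hcs : 1 / 4 < c - s := by rw [hcdef, hsdef]; linarith
  set f : ℕ → ℕ := fun m => ⌊(m : ℝ) ^ γ⌋₊ with hfdef
  set c₃ : ℝ := γ / (2 * H) with hc₃def
  have hc₃ : 0 < c₃ := by rw [hc₃def]; positivity
  -- the constant `K₀ = 2^{1+γ}/h` and the thresholds
  set K₀ : ℝ := 2 * (2 : ℝ) ^ γ / h with hK₀def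
  have hK₀ : 0 < K₀ := by rw [hK₀def]; positivity
  set nthr : ℕ := n₀ + n₁ + 10 + ⌈(33 : ℝ) ^ (1 / γ)⌉₊ + ⌈8 / ε⌉₊ with hnthr
  set N₀ : ℕ := max ((nthr + 1) ^ H) ⌈K₀ ^ (2 * (H : ℝ) / γ)⌉₊ with hN₀def
  refine ⟨c₃, hc₃, N₀, fun N hN R hR L hL => ?_⟩
  have hN1 : (nthr + 1) ^ H ≤ N := le_trans (le_max_left _ _) hN
  have hN2 : ⌈K₀ ^ (2 * (H : ℝ) / γ)⌉₊ ≤ N := le_trans (le_max_right _ _) hN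
  have hNR0 : (0 : ℝ) ≤ N := Nat.cast_nonneg N
  -- `y = N^{1/H}`, `m = ⌊y⌋`
  set y : ℝ := (N : ℝ) ^ (1 / (H : ℝ)) with hydef
  have hy0 : 0 ≤ y := Real.rpow_nonneg hNR0 _
  have hyH : y ^ H = N := by
    rw [hydef, one_div]; exact Real.rpow_inv_natCast_pow hNR0 hH0
  have hythr : (nthr : ℝ) + 1 ≤ y := by
    have h1 : (((nthr + 1) ^ H : ℕ) : ℝ) ≤ N := by exact_mod_cast hN1
    have h2 : ((((nthr + 1) ^ H : ℕ) : ℝ)) ^ (1 / (H : ℝ)) ≤ y :=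
      Real.rpow_le_rpow (Nat.cast_nonneg _) h1 (by positivity)
    have h3 : ((((nthr + 1) ^ H : ℕ) : ℝ)) ^ (1 / (H : ℝ)) = nthr + 1 := by
      push_cast
      rw [one_div]
      exact Real.pow_rpow_inv_natCast (by positivity) hH0
    linarith
  set m : ℕ := ⌊y⌋₊ with hmdef
  have hmy : (m : ℝ) ≤ y := Nat.floor_le hy0
  have hmy' : y - 1 ≤ (m : ℝ) := (Nat.sub_one_lt_floor y).le
  have hmthr : nthr ≤ m := by
    have : (nthr : ℝ) ≤ m := by linarith
    exact_mod_cast this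
  have hnthr10 : (10 : ℝ) ≤ nthr := by exact_mod_cast (by omega : 10 ≤ nthr)
  have hmy2 : y / 2 ≤ (m : ℝ) := by linarith
  have hmH : m ^ H ≤ N := by
    have h1 : ((m : ℝ)) ^ H ≤ y ^ H := pow_le_pow_left₀ (Nat.cast_nonneg m) hmy H
    rw [hyH] at h1
    exact_mod_cast h1
  -- consequences of `m ≥ nthr`
  have hmn₀ : n₀ ≤ m := by omega
  have hmn₁ : n₁ ≤ m := by omega
  have hm10 : 10 ≤ m := by omega
  have hmR : (10 : ℝ) ≤ m := by exact_mod_cast hm10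
  have hm0 : (0 : ℝ) < m := by linarith
  have hm33 : (33 : ℝ) ≤ (m : ℝ) ^ γ := by
    have h1 : ⌈(33 : ℝ) ^ (1 / γ)⌉₊ ≤ m := by omega
    have h2 : (33 : ℝ) ^ (1 / γ) ≤ m := (Nat.le_ceil _).trans (by exact_mod_cast h1)
    calc (33 : ℝ) = ((33 : ℝ) ^ (1 / γ)) ^ γ := by
          rw [← Real.rpow_mul (by norm_num), one_div, inv_mul_cancel₀ hγ.ne', Real.rpow_one]
      _ ≤ (m : ℝ) ^ γ := Real.rpow_le_rpow (by positivity) h2 hγ.le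
  have hm8 : 8 / ε ≤ (m : ℝ) := by
    have h1 : ⌈8 / ε⌉₊ ≤ m := by omega
    exact (Nat.le_ceil _).trans (by exact_mod_cast h1)
  have h1mε : 1 / (m : ℝ) ≤ ε / 8 := by
    have h1 : 1 / (m : ℝ) ≤ 1 / (8 / ε) := one_div_le_one_div_of_le (by positivity) hm8
    rwa [one_div_div] at h1
  have h1m : 1 / (m : ℝ) ≤ 1 / 10 := one_div_le_one_div_of_le (by norm_num) hmR
  -- `f(m) = ⌊m^γ⌋`: `32 ≤ f(m)`, `f(m) ≥ m^γ/2`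
  have hfm_ge : (m : ℝ) ^ γ - 1 ≤ ((f m : ℕ) : ℝ) := (Nat.sub_one_lt_floor _).le
  have h32 : 16 * 2 ≤ f m := by
    show 32 ≤ f m
    apply Nat.le_floor
    push_cast
    linarith
  have hfm2 : (m : ℝ) ^ γ / 2 ≤ ((f m : ℕ) : ℝ) := by linarith
  -- Sherali–Adams fails `(c,s)` at degree `f(m)` on `m` vertices
  have hSA : ¬ SAAchieves (n := m) maxCutPreds (f m) c s := HCMM m hmn₁
  -- the restricted relaxation achieves `(c − 1/m, s)` on `m^H` variables
  have hgap : 1 / (m : ℝ) < c - s := by linarith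
  have hρ : (2 - ε) * s ≤ c - 1 / m := by
    have h1 : (2 - ε) * s = 1 - ε / 4 - ε ^ 2 / 8 := by rw [hsdef]; ring
    rw [h1, hcdef]
    nlinarith [sq_nonneg ε]
  have hc0 : 0 ≤ c - 1 / m := by rw [hcdef]; linarith
  have hAch : (L.restrict (Fin.castLEEmb hmH)).Achieves (c - 1 / m) s :=
    (hL.achieves hs0 hρ hc0).restrict _
  -- the size bound: `R < 2^{N^{c₃}} ≤ m^{h f(m)}`
  have hNc₃ : K₀ ≤ (N : ℝ) ^ c₃ := by
    have h1 : K₀ ^ (2 * (H : ℝ) / γ) ≤ N := (Nat.le_ceil _).trans (by exact_mod_cast hN2)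
    have h2 : (K₀ ^ (2 * (H : ℝ) / γ)) ^ c₃ ≤ (N : ℝ) ^ c₃ :=
      Real.rpow_le_rpow (by positivity) h1 hc₃.le
    have h3 : (K₀ ^ (2 * (H : ℝ) / γ)) ^ c₃ = K₀ := by
      rw [← Real.rpow_mul hK₀.le, hc₃def]
      rw [show 2 * (H : ℝ) / γ * (γ / (2 * H)) = 1 by field_simp, Real.rpow_one]
    linarith
  have hNγH : (N : ℝ) ^ (γ / H) = (N : ℝ) ^ c₃ * (N : ℝ) ^ c₃ := by
    rw [← Real.rpow_add' hNR0, hc₃def]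
    · ring_nf
    · rw [hc₃def]; positivity
  have hyγ : y ^ γ = (N : ℝ) ^ (γ / H) := by
    rw [hydef, ← Real.rpow_mul hNR0]; ring_nf
  have hmγ : (N : ℝ) ^ (γ / H) / (2 : ℝ) ^ γ ≤ (m : ℝ) ^ γ := by
    rw [← hyγ, div_le_iff₀ (by positivity), ← Real.mul_rpow hm0.le (by norm_num)]
    exact Real.rpow_le_rpow hy0 (by linarith) hγ.le
  have hkey : (2 : ℝ) ^ ((N : ℝ) ^ c₃) ≤ (m : ℝ) ^ (h * (f m : ℕ)) := by
    rw [Real.rpow_def_of_pos two_pos, Real.rpow_def_of_pos hm0, Real.exp_le_exp]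
    have hlog2 : 0 < Real.log 2 := Real.log_pos one_lt_two
    have hlog2m : Real.log 2 ≤ Real.log m := Real.log_le_log two_pos (by linarith)
    have hNc0 : 0 ≤ (N : ℝ) ^ c₃ := Real.rpow_nonneg hNR0 _
    have h2γ : 0 < (2 : ℝ) ^ γ := by positivity
    -- `log 2 · N^{c₃} ≤ log 2 · (h/2^{1+γ}) N^{c₃} N^{c₃} ≤ log 2 · h · m^γ/2 ≤ log m · h · f(m)`
    have h1 : (N : ℝ) ^ c₃ ≤ h / (2 * (2 : ℝ) ^ γ) * ((N : ℝ) ^ c₃ * (N : ℝ) ^ c₃) := by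
      have : h / (2 * (2 : ℝ) ^ γ) * K₀ = 1 := by rw [hK₀def]; field_simp
      calc (N : ℝ) ^ c₃ = h / (2 * (2 : ℝ) ^ γ) * K₀ * (N : ℝ) ^ c₃ := by rw [this, one_mul]
        _ ≤ h / (2 * (2 : ℝ) ^ γ) * (N : ℝ) ^ c₃ * (N : ℝ) ^ c₃ := by
            apply mul_le_mul_of_nonneg_right _ hNc0
            exact mul_le_mul_of_nonneg_left hNc₃ (by positivity)
        _ = h / (2 * (2 : ℝ) ^ γ) * ((N : ℝ) ^ c₃ * (N : ℝ) ^ c₃) := by ring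
    have h2 : h / (2 * (2 : ℝ) ^ γ) * ((N : ℝ) ^ c₃ * (N : ℝ) ^ c₃) ≤ h * ((m : ℝ) ^ γ / 2) := by
      rw [← hNγH]
      have := mul_le_mul_of_nonneg_left hmγ hh.le
      calc h / (2 * (2 : ℝ) ^ γ) * (N : ℝ) ^ (γ / H) = h * ((N : ℝ) ^ (γ / H) / (2 : ℝ) ^ γ) / 2 := by
            field_simp
        _ ≤ h * (m : ℝ) ^ γ / 2 := by linarith
        _ = h * ((m : ℝ) ^ γ / 2) := by ring
    have h3 : h * ((m : ℝ) ^ γ / 2) ≤ h * ((f m : ℕ) : ℝ) := mul_le_mul_of_nonneg_left hfm2 hh.le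
    calc Real.log 2 * (N : ℝ) ^ c₃ ≤ Real.log 2 * (h * ((f m : ℕ) : ℝ)) :=
          mul_le_mul_of_nonneg_left (h1.trans (h2.trans h3)) hlog2.le
      _ ≤ Real.log m * (h * ((f m : ℕ) : ℝ)) :=
          mul_le_mul_of_nonneg_right hlog2m (by positivity)
  have hRle : (R : ℝ) ≤ (m : ℝ) ^ (h * (f m : ℕ)) := (hR.trans_le hkey).le
  exact T12 2 maxCutPreds c s hc1 f m hmn₀ hgap h32 hSA R hRle _ hAch

end Literature.Combinatorics.Optimization

end
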